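import Literature.NumberTheory.LFunctions.WeilWindowSimpleEven
import Literature.NumberTheory.LFunctions.WeilExplicitProofs
import Summits.RiemannHypothesis.RiemannHypothesis.Theorems.WeilCombCombSubcriticalEffectiveAux

/-!
# `SignCone.SignConeDuality`, line `Sketch` — stub `stub_scaling`
(crux item stmt-RiemannHypothesis-16304, route route-RiemannHypothesis-SignCone)

HOMOGENEITY of the prime-free Weil form `W_ar := weilPolarTerm + weilArchTerm`:
`W_ar(c · F) = c · W_ar(F)` for every constant `c : ℂ` and every `F : ℝ → ℂ`, with no
hypotheses on `F` (Bochner integrals commute with constants also in the junk regime).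
The cone-multiplier engine of the duality step uses it to see that the image cone is closed
under positive scaling.

Proof: `(c F)^ = c F̂` (`weilMellin_const_mul`), hence the polar term scales; the archimedean
term scales by the landed `WeilCombBohrFejer.weilArchTerm_const_mul`
(Theorems/WeilCombCombSubcriticalEffectiveAux.lean, itself `integral_const_mul`).
-/

noncomputable section

-- `Summit.RiemannHypothesis.RiemannHypothesis.…` repeats a namespace component by design (D-0017 layout).
set_option linter.dupNamespace false

open scoped BigOperators ComplexConjugate
open Complex MeasureTheory Set

namespace Summit.RiemannHypothesis.RiemannHypothesis.Theorems.SignConeDuality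

open Literature.NumberTheory.LFunctions

/-- **Homogeneity of the prime-free Weil form** `W_ar := weilPolarTerm + weilArchTerm`:
`W_ar(c F) = c W_ar(F)` for every `c : ℂ` and every `F : ℝ → ℂ` (no hypotheses on `F`:
both sides carry the same junk values). [folklore] -/
theorem stub_scaling : ∀ (c : ℂ) (F : ℝ → ℂ),
    weilPolarTerm (fun t => c * F t) + weilArchTerm (fun t => c * F t) =
      c * (weilPolarTerm F + weilArchTerm F) := by
  intro c F
  rw [WeilCombBohrFejer.weilArchTerm_const_mul c F]
  simp only [weilPolarTerm, weilMellin_const_mul]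
  ring

end Summit.RiemannHypothesis.RiemannHypothesis.Theorems.SignConeDuality

end
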